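import Summits.BirchSwinnertonDyer.BirchSwinnertonDyer.Theorems.ByReductionTypeAtTwoOrdKatoHalfAtTwoIsoRelaxedGenuineOptimal
import Summits.BirchSwinnertonDyer.BirchSwinnertonDyer.Theorems.ByReductionTypeAtTwoOrdKatoHalfAtTwoIsoRelaxedGenuineResidual
import Summits.BirchSwinnertonDyer.BirchSwinnertonDyer.Theorems.ByReductionTypeAtTwoOrdKatoHalfAtTwoIsoPosDiscRealSignature
import Summits.BirchSwinnertonDyer.BirchSwinnertonDyer.Theorems.AlignedTransportAtTwoMainConjectureOfRankZeroBSDAtTwoFineRoadRelaxedFineFinite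
import Summits.BirchSwinnertonDyer.BirchSwinnertonDyer.Theorems.SignedLowerHalvesSmallImageMuZeroOneSignFinePivotDichotomy
import HarnessLib

/-!
# Route ByReductionTypeAtTwo, crux `OrdKatoHalfAtTwoIso` (stmt-BirchSwinnertonDyer-19573): the crux BY NAME in the GENUINE-RELAXED
# currency — F1μι⁻ · R⁺ · R-opt (memo, Kato's genuine zeta classes) + Aʳ (reserve) + Q⁺ (research stub) + R∞ (residual) + print —
# and the two BRIDGES between the residual texts R∞ (absolute, w2) and R∞⁺ (implication form, lead g7) asked by pen RC-423

Seat `cruxlead-stmt-BirchSwinnertonDyer-19573-w2` GEN 5 (prover WIDTH under the LEAD lineage `cruxlead-19573`; HOME `run/shared/lean/pub/bsd-2adic/`;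
pen RC-417 (2), RC-422/RC-423). A glue file joining `…RelaxedGenuineOptimal` (p706741: R-opt, B7′ BY NAME), `…RelaxedGenuineResidual`
(p706991: R∞ = `FineArchimedeanKernelMuZeroOrdPosDisc`, Thm I, the conjunct door) and the lead's `…PosDiscRealSignature` (p706938: R∞⁺ =
`RealSignatureFineTwoOrdPosDisc`, «Sel₀[2] finite ⟹ Sel₀^{rel ∞}[2] finite»). ONE-WRITER WORD (RC-423): R∞⁺ := the lead's text (the
RESIDUAL «given Q⁺»), R∞ := w2's text (the ABSOLUTE archimedean-kernel statement); this file makes each reachable from the other BY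
NAME: `realSignature_of_fineArchKernel` (R∞ ⟹ R∞⁺, UNCONDITIONAL — Thm I per datum + «`ℓ₍₂₎(X₀^{rel}) = 0` ⟹ `Sel₀^{rel}[2]` finite» by
`μ = 0 ⟺ f.g. over ℤ₂` and Pontryagin duality, the kernel `(Sel₀^{rel}/Sel₀)^∨` being `2`-torsion) and
`fineArchKernel_of_realSignature_of_conjA` (Q⁺ ∧ R∞⁺ ⟹ R∞ on the cell). HONEST FRAMING (cell bsd-2adic): THEOREMS ONLY, CONDITIONAL
on displayed OPEN statements; the relaxed road is the DISPLAYED ALTERNATIVE door (RC-422 (1)), not the registered one; the crux is NOT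
proved; BSD is not proved by any of this.

* `ordKatoHalfAtTwoIso_of_negDisc_of_relaxedZeta_of_arch_of_conjA_of_fineArchKernel` — crux BY NAME ⟸ F1μι⁻ + R⁺ + R-opt + Aʳ + Q⁺ + R∞⁺ +
  PRINT {bundle, modularity, Lim@2 upstairs, FW}.
* `ordKatoHalfAtTwoIso_of_negDisc_of_relaxedZeta_of_arch_of_classicalMu_via_residual` — the same with (Q⁺, R∞) ⟸ Iw⁺ (Thm H mod Lim).
* BRIDGES (RC-423): `finite_fineRelaxed_twoTorsion_of_lengthAt_eq_zero` (per datum: `ℓ₍₂₎(X₀^{rel}) = 0` ⟹ `Sel₀^{rel ∞}[2]` finite, given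
  `Sel₀[2]` finite), `realSignature_of_fineArchKernel` (R∞ ⟹ R∞⁺), `fineArchKernel_of_realSignature_of_conjA` (Q⁺ ∧ R∞⁺ ⟹ R∞).

References: [Kato2004Asterisque] §17.13; reserve [ASP] Thm 6.9; [CoatesSujatha2005] (A); [Lim2017FineSelmer] Thm 3.5; triage r1-2 Thm I / Thm H;
pen RC-417/422/423; [LimSujatha2018] §3; tree p695020, p705378, p706741, p706938, p706991, `…FineRoadRelaxedFine{,Finite}` (bsd-f1-sign2),
`SignedLowerHalvesSmallImageMuZeroOneSignFinePivotDichotomy` (generic Pontryagin transfer).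
-/

set_option autoImplicit false
set_option linter.dupNamespace false

noncomputable section

open scoped Classical MatrixGroups ModularForm NumberField
open CongruenceSubgroup WeierstrassCurve Field IsDedekindDomain NumberField
open Literature.NumberTheory.GaloisRepresentations
open Literature.NumberTheory.GaloisCohomology
open Literature.NumberTheory.EllipticCurves Literature.NumberTheory.EllipticCurves.ModularForms
open Literature.NumberTheory.EllipticCurves.Kato2004
  Literature.NumberTheory.EllipticCurves.Kato2004.EulerSystemValues
open Literature.NumberTheory.EllipticCurves.Rank1Residual
open Literature.NumberTheory.EllipticCurves.Greenberg1999
open Literature.NumberTheory.IwasawaTheory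
open Summit.BirchSwinnertonDyer.BirchSwinnertonDyer.Theorems.Rank1ResidualX1Defs
  Summit.BirchSwinnertonDyer.BirchSwinnertonDyer.Rank1Residual
  Summit.BirchSwinnertonDyer.BirchSwinnertonDyer.Rank1Residual.CoreAssembly
open Summit.BirchSwinnertonDyer.Rank1Residual Summit.BirchSwinnertonDyer.Rank1Residual.X5
  Summit.BirchSwinnertonDyer.Rank1Residual.X1.MuLambda
open Summit.BirchSwinnertonDyer.BirchSwinnertonDyer.Theorems.OrdKatoOptimalAtTwo
  Summit.BirchSwinnertonDyer.BirchSwinnertonDyer.Theorems.OrdKatoIntAtTwo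
open Summit.BirchSwinnertonDyer.BirchSwinnertonDyer.Theses.ByReductionTypeAtTwo
open Summit.BirchSwinnertonDyer.BirchSwinnertonDyer.Theorems.AlignedTransportAtTwoFineRoad

namespace Summit.BirchSwinnertonDyer.BirchSwinnertonDyer.Theorems.SteinbergFibreAtTwo

/-- **The crux `OrdKatoHalfAtTwoIso` (stmt-BirchSwinnertonDyer-19573) BY NAME in the v16-shaped GENUINE currency** (pen RC-417 (2)):
memo readings F1μι⁻ (`Δ < 0`, onto), R⁺ (`0 < Δ`, onto), R-opt (not onto, lattice-optimal member) — Kato's GENUINE zeta classes in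
ι-keyed Coleman coordinates on strict resp. relaxed-at-`∞` carriers, NO half class —, the reserve text Aʳ (archimedean `Λ/2`), the
research stub Q⁺ (Coates–Sujatha (A) at `2` on the onto-`0 < Δ` cell, kernel-NECESSARY p703881) with its residual R∞⁺ («Iw⁺ given
Q⁺», Thm I), and PRINT {the bundle (PUB ∧ Abbes–Ullmo ∧ Greenberg 5.14@2), modularity, Lim 2017 Thm 3.5 at `2` upstairs,
Ferrero–Washington}. Assembly: lead g5's split glue `ordKatoHalfAtTwoIso_of_iota_halves` with the `0 < Δ` conjunct from
`ordKatoHalfAtTwoIsoPosDisc_of_relaxedZeta_of_arch_of_conjA_of_fineArchKernel` (p706991) and B7′ from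
`katoMuPartOff514_of_print_of_relaxedZetaOptimal_of_arch` (p706741). Compare `ordKatoHalfAtTwoIso_of_negDisc_of_relaxedZeta_of_arch_of_lim_upstairs`
(Iw⁺ in place of Q⁺ ∧ R∞⁺) and the (ε) composition `ordKatoHalfAtTwoIso_of_negDisc_of_colemanMu_of_lim_of_classicalMu` (half-class
packages). CONDITIONAL on the displayed OPEN statements; the crux is NOT closed by this; BSD is not proved by any of this.
[cite: Kato2004Asterisque, Thm. 12.6, 16.6, 17.4, Prop. 17.11, §17.13 (shape)] [cite: CoatesSujatha2005, Conj. A (shape)]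
[cite: Lim2017FineSelmer, §3 Thm. 3.5] [cite: FerreroWashington1979, Theorem] [cite: AbbesUllmo1996, Thm. A] -/
theorem ordKatoHalfAtTwoIso_of_negDisc_of_relaxedZeta_of_arch_of_conjA_of_fineArchKernel (hNeg : ZetaColemanMuIotaNegDiscAtTwo)
    (hR : RelaxedZetaColemanIotaPosDiscAtTwo) (hRopt : RelaxedZetaColemanIotaOptimalAtTwo) (hA : ArchimedeanLambdaModTwoOrdAtTwo)
    (hQ : FineSelmerConjATwoOrdPosDisc) (hRinf : FineArchimedeanKernelMuZeroOrdPosDisc)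
    (hLim : Lim2017.thm35_at_two_upstairs_fineSelmer_twoTorsion_finite_of_classicalMuVanishes)
    (hFW : ferreroWashington1979_classicalMuVanishes) (hMod : nonempty_modularParametrizationData)
    (hbundle : OrdPublishedInputsAtTwo ∧ abbesUllmo_not_dvd_maninConstant_of_not_dvd_level ∧
      Greenberg1999.prop514_isTorsion_mu_eq_zero_two) : OrdKatoHalfAtTwoIso := by
  have hAU : abbesUllmo_not_dvd_maninConstant_of_not_dvd_level := hbundle.2.1
  obtain ⟨_, _, h17, _⟩ := hbundle.1
  exact ordKatoHalfAtTwoIso_of_iota_halves hNeg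
    (ordKatoHalfAtTwoIsoPosDisc_of_relaxedZeta_of_arch_of_conjA_of_fineArchKernel hR hA hQ hRinf hAU h17) hbundle
    (katoMuPartOff514_of_print_of_relaxedZetaOptimal_of_arch hAU hMod hLim hFW hRopt hA)

/-- **The same with the research pair (Q⁺, R∞⁺) supplied by Iw⁺** (Thm H modulo the Lim@2-upstairs named fact, p706991) — a consistency
check that the two genuine-currency compositions agree. CONDITIONAL; nothing closed. [cite: Lim2017FineSelmer, §3 Thm. 3.5]
[cite: Iwasawa1973MuInvariants, §1 (shape)] -/
theorem ordKatoHalfAtTwoIso_of_negDisc_of_relaxedZeta_of_arch_of_classicalMu_via_residual (hNeg : ZetaColemanMuIotaNegDiscAtTwo)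
    (hR : RelaxedZetaColemanIotaPosDiscAtTwo) (hRopt : RelaxedZetaColemanIotaOptimalAtTwo) (hA : ArchimedeanLambdaModTwoOrdAtTwo)
    (hIw : ClassicalMuTwoDivisionFieldAdjoinIOrdPosDisc)
    (hLim : Lim2017.thm35_at_two_upstairs_fineSelmer_twoTorsion_finite_of_classicalMuVanishes)
    (hFW : ferreroWashington1979_classicalMuVanishes) (hMod : nonempty_modularParametrizationData)
    (hbundle : OrdPublishedInputsAtTwo ∧ abbesUllmo_not_dvd_maninConstant_of_not_dvd_level ∧
      Greenberg1999.prop514_isTorsion_mu_eq_zero_two) : OrdKatoHalfAtTwoIso :=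
  ordKatoHalfAtTwoIso_of_negDisc_of_relaxedZeta_of_arch_of_conjA_of_fineArchKernel hNeg hR hRopt hA
    (fineSelmerConjATwoOrdPosDisc_of_lim_upstairs_of_classicalMu hLim hIw)
    (fineArchKernelMuZero_of_lim_upstairs_of_classicalMu hLim hIw) hLim hFW hMod hbundle

/-! ## The two BRIDGES between R∞ (absolute) and R∞⁺ (implication form) — pen RC-423 one-writer word -/

section Bridges

variable {W : WeierstrassCurve ℚ} [W.IsElliptic] {κ : ZpExtension ℚ 2} {γ : absoluteGaloisGroup ℚ}

/-- **Per datum: `ℓ₍₂₎(X₀^{rel ∞}) = 0` and «`Sel₀[2]` finite» ⟹ «`Sel₀^{rel ∞}[2]` finite»** (topological generator `γ`). `X₀^{rel ∞}` is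
finitely generated over `Λ` unconditionally (bsd-f1-sign2 `RelaxedFineFinite.module_finite_fineRelaxedInf`) and TORSION: an extension of
`X₀` (torsion with `X₀/2` finite, from «`Sel₀[2]` finite») by `ker(X₀^{rel} ↠ X₀) = (Sel₀^{rel}/Sel₀)^∨`, which is killed by `2`
(`RelaxedRestrict.two_smul_eq_zero_of_mem_ker_relaxedRestrict`: `2·H¹(ℝ, ·) = 0`); so `ℓ₍₂₎ = 0` means `μ = 0`, i.e. finitely generated
over `ℤ₂` (Washington §13.2, tree `muInvariant_eq_zero_iff_holds`), and Pontryagin duality gives the finite `2`-torsion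
(`SmallImageFinePivot.finite_pTorsion_of_moduleFinite_padicInt`, Lim–Sujatha's lemma). [cite: Washington1997, §13.2]
[cite: LimSujatha2018, §3 (before Prop. 3.2)] [cite: GreenbergLNM1716, §1 p. 60 and §4 Lemma 4.6] -/
theorem finite_fineRelaxed_twoTorsion_of_lengthAt_eq_zero (hγ : κ.IsTopGenerator γ) (Yr : W.FineSelmerDualDataRelaxedInf κ γ)
    (hfin : Set.Finite {s : W.fineSelmerInfty κ | 2 • s = 0})
    (hYr0 : Module.lengthAt (IwasawaAlgebra 2) Yr.X ⟨IwasawaAlgebra.augIdealP 2, IwasawaAlgebra.isPrime_augIdealP_holds 2⟩ = 0) :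
    Set.Finite {s : W.fineSelmerInftyRelaxedInf κ | 2 • s = 0} := by
  let Y : W.FineSelmerDualData κ γ := W.fineSelmerDualData κ hγ
  obtain ⟨r, hrY⟩ := RelaxedRestrict.exists_relaxedRestrict W κ hγ Yr Y
  haveI : Module.Finite (IwasawaAlgebra 2) Yr.X := RelaxedFineFinite.module_finite_fineRelaxedInf W κ hγ Yr
  haveI : Module.Finite (IwasawaAlgebra 2) Y.X := Y.module_finite_of_finite_pTorsion hγ hfin
  -- `X₀` torsion (from `X₀/2` finite), `ker r` torsion (killed by `2`), hence `X₀^{rel}` torsion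
  have hTY : Module.IsTorsion (IwasawaAlgebra 2) Y.X :=
    IwasawaModuleFinitePadicInt.isTorsion_of_finite_quotient_augIdealP 2 Y.X (Y.finite_quotient_augIdealP_of_finite_pTorsion hfin)
  have h2 : (PowerSeries.C ((2 : ℕ) : ℤ_[2]) : IwasawaAlgebra 2) ≠ 0 := (IwasawaAlgebra.prime_C 2).ne_zero
  have hTK : Module.IsTorsion (IwasawaAlgebra 2) (LinearMap.ker r) := by
    intro x
    refine ⟨⟨PowerSeries.C ((2 : ℕ) : ℤ_[2]), mem_nonZeroDivisors_of_ne_zero h2⟩, Subtype.ext ?_⟩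
    have hx : (2 : ℕ) • (x : Yr.X) = 0 := RelaxedRestrict.two_smul_eq_zero_of_mem_ker_relaxedRestrict W κ Yr Y r hrY x.2
    rw [Submonoid.mk_smul, Submodule.coe_smul, map_natCast, Nat.cast_smul_eq_nsmul, hx, Submodule.coe_zero]
  have hT : Module.IsTorsion (IwasawaAlgebra 2) Yr.X :=
    Module.isTorsion_of_exact (LinearMap.ker r).subtype r (LinearMap.exact_subtype_ker_map r) hTK hTY
  -- `μ(X₀^{rel}) = 0`, hence finitely generated over `ℤ₂`
  have hμ : muInvariant 2 Yr.X = 0 := by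
    rw [muInvariant_eq_toNat_lengthAt 2 Yr.X ⟨IwasawaAlgebra.augIdealP 2, IwasawaAlgebra.isPrime_augIdealP_holds 2⟩ rfl, hYr0]
    rfl
  have hfg : Module.Finite ℤ_[2] (RestrictScalars ℤ_[2] (IwasawaAlgebra 2) Yr.X) := (muInvariant_eq_zero_iff_holds 2 Yr.X hT).mp hμ
  exact SmallImageFinePivot.finite_pTorsion_of_moduleFinite_padicInt (LimRelUpstairs.isDualPair_relaxed W κ hγ Yr) hfg

end Bridges

/-- **BRIDGE 1 (RC-423): R∞ ⟹ R∞⁺, UNCONDITIONAL** — the absolute archimedean-kernel statement `FineArchimedeanKernelMuZeroOrdPosDisc` (w2)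
implies the lead's implication form `RealSignatureFineTwoOrdPosDisc` («`Sel₀[2]` finite ⟹ `Sel₀^{rel ∞}[2]` finite»): pick a topological
generator, take the constructed strict/relaxed data and their restriction `r`; Thm I per datum gives `ℓ₍₂₎(X₀^{rel}) = ℓ₍₂₎(ker r) +
ℓ₍₂₎(X₀) = 0 + 0`, then `finite_fineRelaxed_twoTorsion_of_lengthAt_eq_zero`. [cite: GreenbergLNM1716, §4 Lemma 4.6] [cite: LimSujatha2018, §3] -/
theorem realSignature_of_fineArchKernel (hRinf : FineArchimedeanKernelMuZeroOrdPosDisc) : RealSignatureFineTwoOrdPosDisc := by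
  intro W _ _ hcm hr hgo h2 hΔ κ hκ hfin
  obtain ⟨γ, hγ⟩ : ∃ γ : absoluteGaloisGroup ℚ, κ.IsTopGenerator γ := κ.surjective (Multiplicative.ofAdd 1)
  let Y : W.FineSelmerDualData κ γ := W.fineSelmerDualData κ hγ
  let Yr : W.FineSelmerDualDataRelaxedInf κ γ := W.fineSelmerDualDataRelaxedInf κ hγ
  obtain ⟨r, hrY⟩ := RelaxedRestrict.exists_relaxedRestrict W κ hγ Yr Y
  refine finite_fineRelaxed_twoTorsion_of_lengthAt_eq_zero hγ Yr hfin ?_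
  rw [lengthAt_fineRelaxed_eq_zero_iff_ker_and_fine Y Yr r hrY]
  exact ⟨hRinf W hcm hr hgo h2 hΔ κ γ hκ hγ Y Yr r hrY,
    AlignedTransportAtTwoFineRoad.lengthAt_fineSelmerDual_eq_zero_of_finite_twoTorsion W hγ Y hfin⟩

/-- **BRIDGE 2 (RC-423): Q⁺ ∧ R∞⁺ ⟹ R∞ on the cell** — the lead's `relaxedConjATwoPosDisc_of_conjA_of_realSignature` (relaxed (A₂) in the
door's currency) followed by w2's `fineArchKernelMuZero_of_relaxedConjATwoPosDisc` (Thm I per datum, «⟹ R∞» half). So every door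
stated with one residual text is reachable from the other BY NAME (given Q⁺ for the direction R∞⁺ ⟹ R∞). [cite: CoatesSujatha2005, Conj. A (shape)]
[cite: GreenbergLNM1716, §4 Lemma 4.6] -/
theorem fineArchKernel_of_realSignature_of_conjA (hQ : FineSelmerConjATwoOrdPosDisc) (hR : RealSignatureFineTwoOrdPosDisc) :
    FineArchimedeanKernelMuZeroOrdPosDisc :=
  fineArchKernelMuZero_of_relaxedConjATwoPosDisc (relaxedConjATwoPosDisc_of_conjA_of_realSignature hQ hR)

/-- **The two residual texts are EQUIVALENT given Q⁺** (Thm I; RC-423). [cite: GreenbergLNM1716, §4 Lemma 4.6 (shape)] -/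
theorem fineArchKernel_iff_realSignature_of_conjA (hQ : FineSelmerConjATwoOrdPosDisc) :
    FineArchimedeanKernelMuZeroOrdPosDisc ↔ RealSignatureFineTwoOrdPosDisc :=
  ⟨realSignature_of_fineArchKernel, fineArchKernel_of_realSignature_of_conjA hQ⟩

end Summit.BirchSwinnertonDyer.BirchSwinnertonDyer.Theorems.SteinbergFibreAtTwo

end
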